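import Mathlib
import Summits.NavierStokesRegularity.NavierStokesRegularity.Theorems.EulerZoomLiouvillePowerGaugeEulerLiouvilleSelfSimilarTransfer
import HarnessLib

/-!
# THE GAUGES OF AN EXACTLY SELF-SIMILAR TRIPLE ARE ANTITONE IN THE SCALE (no profile regularity)
# (crux `EulerZoomLiouville.PowerGaugeEulerLiouville` = stmt-NavierStokesRegularity-19832; line `logtime-breathers`, residue T4 «window clocks» — tools for the
# LOCAL form of the centre/exponent transfer, `…ClockTransferLocal`)

Route `EulerZoomLiouville` (NavierStokesRegularity); width seat ns-ezl-w6 g2 (LEAD ns-typeII-p2 g12).  For an exactly self-similar triple about the space–time ORIGIN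
at the class rate of `ρ` — `v(τ) = selfSimilarCollapse γ 0 W τ`, `K(τ) = (−τ)^{−1} • G((−τ)^{−γ} ·)`, `q(τ) = selfSimilarCollapsePressure γ 0 Q τ` (`τ < 0`),
`γ(2+ρ) = 1`, `ρ ≥ 0`, ANY profiles — each of the three Seregin gauges `a^{2ρ}A(a;0;v)`, `a^{ρ}E(a;0;K)`, `a^{2ρ}D(a;0;q)` is NON-INCREASING in `a`
(`ClockTransfer.gaugeA_antitone`, `gaugeE_antitone`, `gaugeD_antitone`).  Mechanism: the Euler scaling `Φ(t,x) = (βt, λx)`, `λ = b/a ≥ 1`, `β = λ^{2+ρ}`, FIXES the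
triple (`λ^{1+ρ} v∘Φ = v`, `β K∘Φ = K`, `λ^{2+2ρ} q∘Φ = q` on the slab) and pulls the PARABOLIC cylinder `Q_b(0)` back to `(−b²/β, 0) × B_a ⊆ Q_a(0)` because
`(a/b)^{ρ} ≤ 1` (`preimage_parabolicCylinder_subset`); the tree's covariance lemmas `setLIntegral_frobeniusNormSq_stRescale` / `setLIntegral_enorm_rpow_stRescale` and
the exact slice scaling `lintegral_ball_enorm_sq_selfSimilarCollapse` do the rest.  CONSEQUENCE (sequel): the class-`ρ` gauge sum of such a triple is bounded on ALL
scales as soon as it is bounded on SMALL scales `a ≤ a₀` — a `T₁ = T` power-clock member that is LOCALLY of class `ρ′` at its own collapse point is, recentred,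
GLOBALLY of class `ρ′`, for weak profiles too.  WHAT THIS IS NOT: not NS, not E — scaling lemmas on the MODEL lattice (`--supports` stmt-19832); 19832 OPEN. [folklore]
-/

noncomputable section

-- flat `Theorems/<Route><Decl>…` files of one crux share the namespace of the crux (tree convention: `Summit.<S>.<S>.…`)
set_option linter.dupNamespace false

open MeasureTheory Set Filter Topology Metric Function TopologicalSpace
open scoped ENNReal NNReal

namespace Summit.NavierStokesRegularity.NavierStokesRegularity.Theorems.PowerGaugeEulerLiouville

open Literature.Analysis Literature.Analysis.FunctionSpaces Literature.Analysis.FluidPDE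

namespace ClockTransfer

/-! ### The Euler scaling pulls `Q_b(0)` back into `Q_a(0)` -/

/-- For `0 < a ≤ b`, `λ = b/a`, `β = λ^{2+ρ′}`, `ρ′ ≥ 0`: the preimage of `Q_b(0,0)` under `(t,x) ↦ (βt, λx)` is `(−b²/β, 0) × B_a ⊆ Q_a(0,0)`. [folklore] -/
theorem preimage_parabolicCylinder_subset {ρ a b : ℝ} (hρ : 0 ≤ ρ) (ha : 0 < a) (hab : a ≤ b) :
    stAffine ((b / a) ^ (2 + ρ)) (b / a) 0 (0 : EuclideanSpace ℝ (Fin 3)) ⁻¹'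
        parabolicCylinder b (0 : ℝ × EuclideanSpace ℝ (Fin 3)) ⊆
      parabolicCylinder a (0 : ℝ × EuclideanSpace ℝ (Fin 3)) := by
  have hb : 0 < b := lt_of_lt_of_le ha hab
  have hl : 1 ≤ b / a := by rw [le_div_iff₀ ha]; linarith
  have hl0 : 0 < b / a := by positivity
  have hβ : 0 < (b / a) ^ (2 + ρ) := Real.rpow_pos_of_pos hl0 _
  unfold parabolicCylinder
  rw [Prod.fst_zero, Prod.snd_zero, zero_sub, zero_sub, stAffine_preimage_cylinder hβ hl0, sub_zero, sub_zero, sub_zero,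
    zero_div, smul_zero]
  refine prod_mono ?_ ?_
  · refine Ioo_subset_Ioo ?_ le_rfl
    -- `−a² ≤ −b²/β`, i.e. `b² ≤ a² β`
    rw [neg_div, neg_le_neg_iff, div_le_iff₀ hβ]
    have h2 : (b / a) ^ (2 : ℝ) ≤ (b / a) ^ (2 + ρ) := Real.rpow_le_rpow_of_exponent_le hl (by linarith)
    have h3 : b ^ 2 = a ^ 2 * (b / a) ^ (2 : ℝ) := by
      rw [Real.rpow_two, div_pow]; field_simp
    rw [h3]
    exact mul_le_mul_of_nonneg_left h2 (sq_nonneg _)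
  · rw [show b / (b / a) = a by field_simp]

/-! ### The gauges of an exactly self-similar triple are antitone in the scale -/

/-- **`a ↦ a^{2ρ} A(a; 0; v)` IS NON-INCREASING** for `v(τ) = selfSimilarCollapse γ 0 W τ`, `γ = 1/(2+ρ)`, `ρ ≥ 0`: the slice of `Q_b` at time `t` is the slice of
`Q_a` at time `t (a/b)^{2+ρ} ∈ (−a², 0)` read on the same profile ball. [folklore] -/
theorem gaugeA_antitone {ρ : ℝ} (hρ : 0 ≤ ρ)
    {v : ℝ → EuclideanSpace ℝ (Fin 3) → EuclideanSpace ℝ (Fin 3)} {W : EuclideanSpace ℝ (Fin 3) → EuclideanSpace ℝ (Fin 3)}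
    (hv : ∀ τ : ℝ, τ < 0 → v τ = selfSimilarCollapse (1 / (2 + ρ)) 0 W τ) {a b : ℝ} (ha : 0 < a) (hab : a ≤ b) :
    ENNReal.ofReal (b ^ (2 * ρ)) * cknA b (0 : ℝ × EuclideanSpace ℝ (Fin 3)) v ≤
      ENNReal.ofReal (a ^ (2 * ρ)) * cknA a (0 : ℝ × EuclideanSpace ℝ (Fin 3)) v := by
  have hρ2 : 0 < 2 + ρ := by linarith
  set γ : ℝ := 1 / (2 + ρ) with hγ
  have hγρ : γ * (2 + ρ) = 1 := by rw [hγ]; field_simp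
  have hb : 0 < b := lt_of_lt_of_le ha hab
  set l : ℝ := b / a with hl
  have hl0 : 0 < l := by positivity
  have hl1 : 1 ≤ l := by rw [hl, le_div_iff₀ ha]; linarith
  rw [show cknA b (0 : ℝ × EuclideanSpace ℝ (Fin 3)) v = ⨆ t ∈ Ioo (-b ^ 2) (0 : ℝ),
      (ENNReal.ofReal b)⁻¹ * ∫⁻ x in ball (0 : EuclideanSpace ℝ (Fin 3)) b, ‖v t x‖ₑ ^ 2 from by
    unfold cknA; rw [Prod.fst_zero, Prod.snd_zero, zero_sub], ENNReal.mul_iSup]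
  refine iSup_le fun t => ?_
  rw [ENNReal.mul_iSup]
  refine iSup_le fun ht => ?_
  have ht0 : t < 0 := ht.2
  have hs : 0 < -t := neg_pos.2 ht0
  -- the rescaled time `t' = t · l^{−(2+ρ)}`
  set t' : ℝ := t * l ^ (-(2 + ρ)) with ht'
  have hlpow : 0 < l ^ (-(2 + ρ)) := Real.rpow_pos_of_pos hl0 _
  have hlpow1 : l ^ (-(2 + ρ)) ≤ 1 := Real.rpow_le_one_of_one_le_of_nonpos hl1 (by linarith)
  have ht'0 : t' < 0 := by rw [ht']; exact mul_neg_of_neg_of_pos ht0 hlpow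
  have ht'a : t' ∈ Ioo (-a ^ 2) 0 := by
    refine ⟨?_, ht'0⟩
    -- `−a² < t l^{−(2+ρ)}`: `|t| l^{−(2+ρ)} < b² l^{−(2+ρ)} ≤ b² l^{−2} = a²`
    have h1 : -t * l ^ (-(2 + ρ)) < b ^ 2 * l ^ (-(2 + ρ)) := mul_lt_mul_of_pos_right (by linarith [ht.1]) hlpow
    have h2 : b ^ 2 * l ^ (-(2 + ρ)) ≤ b ^ 2 * l ^ (-(2 : ℝ)) :=
      mul_le_mul_of_nonneg_left (Real.rpow_le_rpow_of_exponent_le hl1 (by linarith)) (sq_nonneg _)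
    have h3 : b ^ 2 * l ^ (-(2 : ℝ)) = a ^ 2 := by
      rw [Real.rpow_neg hl0.le, Real.rpow_two, hl, div_pow]; field_simp
    rw [ht']; nlinarith
  have hs' : 0 < -t' := neg_pos.2 ht'0
  -- the two slices see the same profile ball and differ by the factor `l^{1−2ρ}`
  have hneg : -t' = -t * l ^ (-(2 + ρ)) := by rw [ht']; ring
  have hball : (-t') ^ (-γ) * a = (-t) ^ (-γ) * b := by
    rw [hneg, Real.mul_rpow hs.le hlpow.le, ← Real.rpow_mul hl0.le,
      show -(2 + ρ) * -γ = γ * (2 + ρ) by ring, hγρ, Real.rpow_one, hl]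
    field_simp
  have hfac : (-t') ^ (5 * γ - 2) = (-t) ^ (5 * γ - 2) * l ^ (2 * ρ - 1) := by
    rw [hneg, Real.mul_rpow hs.le hlpow.le, ← Real.rpow_mul hl0.le]
    congr 2
    linear_combination (-5 : ℝ) * hγρ
  have hslice_a : (ENNReal.ofReal a)⁻¹ * ∫⁻ x in ball (0 : EuclideanSpace ℝ (Fin 3)) a, ‖v t' x‖ₑ ^ 2 ≤
      cknA a (0 : ℝ × EuclideanSpace ℝ (Fin 3)) v := by
    unfold cknA
    have ht'' : t' ∈ Ioo ((0 : ℝ × EuclideanSpace ℝ (Fin 3)).1 - a ^ 2) (0 : ℝ × EuclideanSpace ℝ (Fin 3)).1 := by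
      simpa using ht'a
    exact le_iSup₂ (f := fun s (_ : s ∈ Ioo ((0 : ℝ × EuclideanSpace ℝ (Fin 3)).1 - a ^ 2)
        (0 : ℝ × EuclideanSpace ℝ (Fin 3)).1) =>
        (ENNReal.ofReal a)⁻¹ * ∫⁻ x in ball (0 : ℝ × EuclideanSpace ℝ (Fin 3)).2 a, ‖v s x‖ₑ ^ 2) t' ht''
  rw [hv t ht0, lintegral_ball_enorm_sq_selfSimilarCollapse γ ht0 W b]
  rw [hv t' ht'0, lintegral_ball_enorm_sq_selfSimilarCollapse γ ht'0 W a, hball, hfac] at hslice_a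
  -- bookkeeping: `b^{2ρ} b⁻¹ = a^{2ρ} a⁻¹ l^{2ρ−1}`
  have hscal : ENNReal.ofReal (b ^ (2 * ρ)) * (ENNReal.ofReal b)⁻¹ =
      ENNReal.ofReal (a ^ (2 * ρ)) * (ENNReal.ofReal a)⁻¹ * ENNReal.ofReal (l ^ (2 * ρ - 1)) := by
    rw [← ENNReal.ofReal_inv_of_pos hb, ← ENNReal.ofReal_inv_of_pos ha, ← ENNReal.ofReal_mul (by positivity),
      ← ENNReal.ofReal_mul (by positivity), ← ENNReal.ofReal_mul (by positivity)]
    congr 1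
    rw [hl, Real.div_rpow hb.le ha.le, Real.rpow_sub hb, Real.rpow_sub ha, Real.rpow_one, Real.rpow_one]
    field_simp
  set Y := ∫⁻ y in ball (0 : EuclideanSpace ℝ (Fin 3)) ((-t) ^ (-γ) * b), ‖W y‖ₑ ^ 2 with hY
  calc ENNReal.ofReal (b ^ (2 * ρ)) * ((ENNReal.ofReal b)⁻¹ * (ENNReal.ofReal ((-t) ^ (5 * γ - 2)) * Y))
      = ENNReal.ofReal (b ^ (2 * ρ)) * (ENNReal.ofReal b)⁻¹ * (ENNReal.ofReal ((-t) ^ (5 * γ - 2)) * Y) := by ring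
    _ = ENNReal.ofReal (a ^ (2 * ρ)) * ((ENNReal.ofReal a)⁻¹ *
          (ENNReal.ofReal ((-t) ^ (5 * γ - 2) * l ^ (2 * ρ - 1)) * Y)) := by
        rw [hscal, ENNReal.ofReal_mul (Real.rpow_nonneg hs.le _)]; ring
    _ ≤ ENNReal.ofReal (a ^ (2 * ρ)) * cknA a (0 : ℝ × EuclideanSpace ℝ (Fin 3)) v := by gcongr

/-- **`a ↦ a^{ρ} E(a; 0; K)` IS NON-INCREASING** for a self-similar gradient `K(τ) = (−τ)^{−1} • G((−τ)^{−γ} ·)` (`τ < 0`, pointwise; a.e. versions via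
`cknE_congr_ae_slab`), `γ = 1/(2+ρ)`, `ρ ≥ 0`: the Euler scaling `(t,x) ↦ (βt, λx)`, `λ = b/a`, `β = λ^{2+ρ}`, satisfies `β • K ∘ Φ = K` and pulls `Q_b(0)` into
`Q_a(0)` (`preimage_parabolicCylinder_subset`); covariance `setLIntegral_frobeniusNormSq_stRescale`. [folklore] -/
theorem gaugeE_antitone {ρ : ℝ} (hρ : 0 ≤ ρ)
    {K : ℝ → EuclideanSpace ℝ (Fin 3) → EuclideanSpace ℝ (Fin 3) →L[ℝ] EuclideanSpace ℝ (Fin 3)}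
    {G : EuclideanSpace ℝ (Fin 3) → EuclideanSpace ℝ (Fin 3) →L[ℝ] EuclideanSpace ℝ (Fin 3)}
    (hK : ∀ τ : ℝ, τ < 0 → K τ = fun x => (-τ) ^ (-1 : ℝ) • G ((-τ) ^ (-(1 / (2 + ρ))) • x)) {a b : ℝ} (ha : 0 < a) (hab : a ≤ b) :
    ENNReal.ofReal (b ^ ρ) * cknE b (0 : ℝ × EuclideanSpace ℝ (Fin 3)) K ≤
      ENNReal.ofReal (a ^ ρ) * cknE a (0 : ℝ × EuclideanSpace ℝ (Fin 3)) K := by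
  have hρ2 : 0 < 2 + ρ := by linarith
  set γ : ℝ := 1 / (2 + ρ) with hγ
  have hγρ : γ * (2 + ρ) = 1 := by rw [hγ]; field_simp
  have hb : 0 < b := lt_of_lt_of_le ha hab
  set l : ℝ := b / a with hl
  have hl0 : 0 < l := by positivity
  set β : ℝ := l ^ (2 + ρ) with hβ
  have hβ0 : 0 < β := Real.rpow_pos_of_pos hl0 _
  -- self-similarity as a pull-back identity on the slab: `β • K(βt, l x) = K(t, x)` for `t < 0`
  have hfix : ∀ z ∈ stAffine β l 0 (0 : EuclideanSpace ℝ (Fin 3)) ⁻¹' parabolicCylinder b (0 : ℝ × EuclideanSpace ℝ (Fin 3)),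
      ENNReal.ofReal (frobeniusNormSq ((β • stPull β l 0 (0 : EuclideanSpace ℝ (Fin 3)) K) z.1 z.2)) =
        ENNReal.ofReal (frobeniusNormSq (K z.1 z.2)) := by
    intro z hz
    have hz' := preimage_parabolicCylinder_subset hρ ha hab hz
    rw [mem_parabolicCylinder] at hz'
    have ht0 : z.1 < 0 := by simpa using hz'.1.2
    have hs : 0 < -z.1 := neg_pos.2 ht0
    have hβt : β * z.1 < 0 := mul_neg_of_pos_of_neg hβ0 ht0
    congr 2
    change β • K (0 + β * z.1) ((0 : EuclideanSpace ℝ (Fin 3)) + l • z.2) = K z.1 z.2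
    rw [zero_add, zero_add, hK (β * z.1) hβt, hK z.1 ht0]
    dsimp only
    have hneg : -(β * z.1) = β * (-z.1) := by ring
    have h1 : β * (β ^ (-1 : ℝ) * (-z.1) ^ (-1 : ℝ)) = (-z.1) ^ (-1 : ℝ) := by
      rw [← mul_assoc, Real.rpow_neg_one, mul_inv_cancel₀ hβ0.ne', one_mul]
    have h2 : β ^ (-γ) * l = 1 := by
      rw [hβ, ← Real.rpow_mul hl0.le, show (2 + ρ) * -γ = -(γ * (2 + ρ)) by ring, hγρ, Real.rpow_neg_one,
        inv_mul_cancel₀ hl0.ne']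
    have h3 : β ^ (-γ) * (-z.1) ^ (-γ) * l = (-z.1) ^ (-γ) := by
      rw [mul_comm (β ^ (-γ)), mul_assoc, h2, mul_one]
    rw [hneg, Real.mul_rpow hβ0.le hs.le, Real.mul_rpow hβ0.le hs.le, smul_smul, smul_smul, h1, h3]
  -- covariance
  have hcov := setLIntegral_frobeniusNormSq_stRescale (E := EuclideanSpace ℝ (Fin 3)) hβ0 hl0 0 0 β K
    (parabolicCylinder b (0 : ℝ × EuclideanSpace ℝ (Fin 3)))
  rw [setLIntegral_congr_fun ((isOpen_parabolicCylinder _ _).preimage (continuous_stAffine _ _ _ _)).measurableSet hfix,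
    finrank_euclideanSpace_fin] at hcov
  -- `X_b := ∫_{Q_b}|K|²`, `X_a := ∫_{Q_a}|K|²`: `β² (β l³)⁻¹ X_b ≤ X_a`
  set Xb : ℝ≥0∞ := ∫⁻ z in parabolicCylinder b (0 : ℝ × EuclideanSpace ℝ (Fin 3)), ENNReal.ofReal (frobeniusNormSq (K z.1 z.2)) with hXb
  set Xa : ℝ≥0∞ := ∫⁻ z in parabolicCylinder a (0 : ℝ × EuclideanSpace ℝ (Fin 3)), ENNReal.ofReal (frobeniusNormSq (K z.1 z.2)) with hXa
  have hle : ENNReal.ofReal (β ^ 2) * ENNReal.ofReal (β * l ^ 3)⁻¹ * Xb ≤ Xa := by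
    rw [← hcov]
    exact lintegral_mono_set (preimage_parabolicCylinder_subset hρ ha hab)
  -- the constant: `β² (β l³)⁻¹ = l^{1−ρ}`… combined with `b^{ρ} b⁻¹` gives `a^{ρ} a⁻¹`
  have hconst : ENNReal.ofReal (b ^ ρ) * (ENNReal.ofReal b)⁻¹ =
      ENNReal.ofReal (a ^ ρ) * (ENNReal.ofReal a)⁻¹ * (ENNReal.ofReal (β ^ 2) * ENNReal.ofReal (β * l ^ 3)⁻¹) := by
    rw [← ENNReal.ofReal_inv_of_pos hb, ← ENNReal.ofReal_inv_of_pos ha, ← ENNReal.ofReal_mul (by positivity),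
      ← ENNReal.ofReal_mul (by positivity), ← ENNReal.ofReal_mul (by positivity), ← ENNReal.ofReal_mul (by positivity)]
    congr 1
    have hβl : β ^ 2 * (β * l ^ 3)⁻¹ = l ^ (-(1 : ℝ) + ρ) := by
      rw [hβ, mul_inv, ← mul_assoc, sq, mul_assoc (l ^ (2 + ρ)), mul_inv_cancel₀ hβ0.ne', mul_one,
        ← Real.rpow_natCast l 3, ← Real.rpow_neg hl0.le, ← Real.rpow_add hl0]
      congr 1; push_cast; ring
    rw [hβl, hl, Real.div_rpow hb.le ha.le, Real.rpow_add hb, Real.rpow_add ha, Real.rpow_neg_one, Real.rpow_neg_one]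
    field_simp
  unfold cknE
  rw [← hXb, ← hXa]
  calc ENNReal.ofReal (b ^ ρ) * ((ENNReal.ofReal b)⁻¹ * Xb)
      = ENNReal.ofReal (a ^ ρ) * (ENNReal.ofReal a)⁻¹ * (ENNReal.ofReal (β ^ 2) * ENNReal.ofReal (β * l ^ 3)⁻¹ * Xb) := by
        rw [← mul_assoc, hconst]; ring
    _ ≤ ENNReal.ofReal (a ^ ρ) * (ENNReal.ofReal a)⁻¹ * Xa := by gcongr
    _ = ENNReal.ofReal (a ^ ρ) * ((ENNReal.ofReal a)⁻¹ * Xa) := by ring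

/-- **`a ↦ a^{2ρ} D(a; 0; q)` IS NON-INCREASING** for `q(τ) = selfSimilarCollapsePressure γ 0 Q τ` (`τ < 0`), `γ = 1/(2+ρ)`, `ρ ≥ 0` (pressure weight
`λ^{2+2ρ}`, covariance `setLIntegral_enorm_rpow_stRescale`). [folklore] -/
theorem gaugeD_antitone {ρ : ℝ} (hρ : 0 ≤ ρ)
    {q : ℝ → EuclideanSpace ℝ (Fin 3) → ℝ} {Q : EuclideanSpace ℝ (Fin 3) → ℝ}
    (hq : ∀ τ : ℝ, τ < 0 → q τ = selfSimilarCollapsePressure (1 / (2 + ρ)) 0 Q τ) {a b : ℝ} (ha : 0 < a) (hab : a ≤ b) :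
    ENNReal.ofReal (b ^ (2 * ρ)) * cknD b (0 : ℝ × EuclideanSpace ℝ (Fin 3)) q ≤
      ENNReal.ofReal (a ^ (2 * ρ)) * cknD a (0 : ℝ × EuclideanSpace ℝ (Fin 3)) q := by
  have hρ2 : 0 < 2 + ρ := by linarith
  set γ : ℝ := 1 / (2 + ρ) with hγ
  have hγρ : γ * (2 + ρ) = 1 := by rw [hγ]; field_simp
  have hb : 0 < b := lt_of_lt_of_le ha hab
  set l : ℝ := b / a with hl
  have hl0 : 0 < l := by positivity
  set β : ℝ := l ^ (2 + ρ) with hβ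
  have hβ0 : 0 < β := Real.rpow_pos_of_pos hl0 _
  set α : ℝ := l ^ (2 + 2 * ρ) with hα
  have hα0 : 0 < α := Real.rpow_pos_of_pos hl0 _
  -- self-similarity of the pressure: `α q(βt, l x) = q(t, x)` for `t < 0`
  have hfix : ∀ z ∈ stAffine β l 0 (0 : EuclideanSpace ℝ (Fin 3)) ⁻¹' parabolicCylinder b (0 : ℝ × EuclideanSpace ℝ (Fin 3)),
      ‖(α • stPull β l 0 (0 : EuclideanSpace ℝ (Fin 3)) q) z.1 z.2‖ₑ ^ (3 / 2 : ℝ) = ‖q z.1 z.2‖ₑ ^ (3 / 2 : ℝ) := by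
    intro z hz
    have hz' := preimage_parabolicCylinder_subset hρ ha hab hz
    rw [mem_parabolicCylinder] at hz'
    have ht0 : z.1 < 0 := by simpa using hz'.1.2
    have hs : 0 < -z.1 := neg_pos.2 ht0
    have hβt : β * z.1 < 0 := mul_neg_of_pos_of_neg hβ0 ht0
    congr 2
    change α • q (0 + β * z.1) ((0 : EuclideanSpace ℝ (Fin 3)) + l • z.2) = q z.1 z.2
    rw [zero_add, zero_add, hq (β * z.1) hβt, hq z.1 ht0, selfSimilarCollapsePressure_apply, selfSimilarCollapsePressure_apply,
      zero_sub, zero_sub, smul_eq_mul]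
    have hneg : -(β * z.1) = β * (-z.1) := by ring
    have h2 : β ^ (-γ) * l = 1 := by
      rw [hβ, ← Real.rpow_mul hl0.le, show (2 + ρ) * -γ = -(γ * (2 + ρ)) by ring, hγρ, Real.rpow_neg_one,
        inv_mul_cancel₀ hl0.ne']
    have h3 : β ^ (-γ) * (-z.1) ^ (-γ) * l = (-z.1) ^ (-γ) := by
      rw [mul_comm (β ^ (-γ)), mul_assoc, h2, mul_one]
    have h1 : α * β ^ (2 * (γ - 1)) = 1 := by
      rw [hα, hβ, ← Real.rpow_mul hl0.le, ← Real.rpow_add hl0,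
        show 2 + 2 * ρ + (2 + ρ) * (2 * (γ - 1)) = 2 * (γ * (2 + ρ)) - 2 by ring, hγρ]
      norm_num
    rw [hneg, Real.mul_rpow hβ0.le hs.le, Real.mul_rpow hβ0.le hs.le, smul_smul, h3]
    calc α * (β ^ (2 * (γ - 1)) * (-z.1) ^ (2 * (γ - 1)) * Q ((-z.1) ^ (-γ) • z.2))
        = (α * β ^ (2 * (γ - 1))) * ((-z.1) ^ (2 * (γ - 1)) * Q ((-z.1) ^ (-γ) • z.2)) := by ring
      _ = (-z.1) ^ (2 * (γ - 1)) * Q ((-z.1) ^ (-γ) • z.2) := by rw [h1, one_mul]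
  have hcov := setLIntegral_enorm_rpow_stRescale (E := EuclideanSpace ℝ (Fin 3)) hβ0 hl0 0 0 α q
    (parabolicCylinder b (0 : ℝ × EuclideanSpace ℝ (Fin 3))) (r := 3 / 2) (by norm_num)
  rw [setLIntegral_congr_fun ((isOpen_parabolicCylinder _ _).preimage (continuous_stAffine _ _ _ _)).measurableSet hfix,
    finrank_euclideanSpace_fin, Real.enorm_eq_ofReal hα0.le, ENNReal.ofReal_rpow_of_nonneg hα0.le (by norm_num)] at hcov
  set Xb : ℝ≥0∞ := ∫⁻ z in parabolicCylinder b (0 : ℝ × EuclideanSpace ℝ (Fin 3)), ‖q z.1 z.2‖ₑ ^ (3 / 2 : ℝ) with hXb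
  set Xa : ℝ≥0∞ := ∫⁻ z in parabolicCylinder a (0 : ℝ × EuclideanSpace ℝ (Fin 3)), ‖q z.1 z.2‖ₑ ^ (3 / 2 : ℝ) with hXa
  have hle : ENNReal.ofReal (α ^ (3 / 2 : ℝ)) * ENNReal.ofReal (β * l ^ 3)⁻¹ * Xb ≤ Xa := by
    rw [← hcov]
    exact lintegral_mono_set (preimage_parabolicCylinder_subset hρ ha hab)
  have hconst : ENNReal.ofReal (b ^ (2 * ρ)) * (ENNReal.ofReal b ^ 2)⁻¹ =
      ENNReal.ofReal (a ^ (2 * ρ)) * (ENNReal.ofReal a ^ 2)⁻¹ * (ENNReal.ofReal (α ^ (3 / 2 : ℝ)) * ENNReal.ofReal (β * l ^ 3)⁻¹) := by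
    rw [← ENNReal.ofReal_pow hb.le, ← ENNReal.ofReal_pow ha.le, ← ENNReal.ofReal_inv_of_pos (by positivity),
      ← ENNReal.ofReal_inv_of_pos (by positivity), ← ENNReal.ofReal_mul (by positivity),
      ← ENNReal.ofReal_mul (by positivity), ← ENNReal.ofReal_mul (by positivity), ← ENNReal.ofReal_mul (by positivity)]
    congr 1
    have hαl : α ^ (3 / 2 : ℝ) * (β * l ^ 3)⁻¹ = l ^ (-(2 : ℝ) + 2 * ρ) := by
      rw [hα, hβ, ← Real.rpow_mul hl0.le, mul_inv, ← Real.rpow_natCast l 3, ← Real.rpow_neg hl0.le, ← Real.rpow_neg hl0.le,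
        ← Real.rpow_add hl0, ← Real.rpow_add hl0]
      norm_num; ring_nf
    rw [hαl, hl, Real.div_rpow hb.le ha.le, Real.rpow_add hb, Real.rpow_add ha, Real.rpow_neg hb.le, Real.rpow_neg ha.le,
      Real.rpow_two, Real.rpow_two]
    field_simp
  unfold cknD
  rw [← hXb, ← hXa]
  calc ENNReal.ofReal (b ^ (2 * ρ)) * ((ENNReal.ofReal b ^ 2)⁻¹ * Xb)
      = ENNReal.ofReal (a ^ (2 * ρ)) * (ENNReal.ofReal a ^ 2)⁻¹ *
          (ENNReal.ofReal (α ^ (3 / 2 : ℝ)) * ENNReal.ofReal (β * l ^ 3)⁻¹ * Xb) := by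
        rw [← mul_assoc, hconst]; ring
    _ ≤ ENNReal.ofReal (a ^ (2 * ρ)) * (ENNReal.ofReal a ^ 2)⁻¹ * Xa := by gcongr
    _ = ENNReal.ofReal (a ^ (2 * ρ)) * ((ENNReal.ofReal a ^ 2)⁻¹ * Xa) := by ring

end ClockTransfer

end Summit.NavierStokesRegularity.NavierStokesRegularity.Theorems.PowerGaugeEulerLiouville
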